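import Summits.BirchSwinnertonDyer.BirchSwinnertonDyer.Theorems.CyclotomicUntwistWildThreeDicyclicValuedBounds
import Summits.BirchSwinnertonDyer.BirchSwinnertonDyer.Theorems.CyclotomicUntwistWildThreeDicyclicValuedUnits
import HarnessLib

/-!
# `Ψ₃` has AT MOST ONE root in `K_v` on the six DICYCLIC wild cells off `(3, II)` / `(3, IV*)`:
# Tate's normal forms `II (v Δ = 5)`, `IV (v Δ = 5, 7)`, `IV* (v Δ = 11)`, `II* (v Δ = 11, 13)` at `π = 3`

Cell `pub/bsd-wall` (D-0145 line `route-BirchSwinnertonDyer-CyclotomicUntwist`), seat `bsd-line-cycu-p2`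
(prover seat 2/3, gen 4); helper toward K1/K2 (stmt-BirchSwinnertonDyer-21580 / 21581) and the O6 lane:
the SPLIT half of the conjecture-tagged node `Additive.WildThreeTameTorsionCellLaw` ("IRR / SPLIT shapes of
`W[3]|G_{ℚ₃}` occur only in the cells `(v₃N, Kod₃) ∈ {(3, II), (3, IV*)}`") needs "two `ℚ₃`-roots of `Ψ₃`
coincide" on the other six cells with `v₃Δ_min` odd. THEOREMS ONLY (no definition, no named fact, no
`sorry`); BSD is not proved by this file and no crux is.

## What
Over the completion `K_v` of the fraction field of a Dedekind domain at a place `v` with `π = 3` a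
uniformiser, on a `K_v`-model in Tate's normal form `b₂ = π^{k₂}β₂`, `b₄ = π^{k₄}β₄`, `b₆ = π^{k₆}β₆` (`β₆` a
unit), `Δ = πⁿδ` (`δ` a unit) (`exists_variableChange_b_of_kodairaSymbolAt_wild`: `(k₂,k₄,k₆) = (1,1,1)` II,
`(1,2,2)` IV, `(2,3,4)` IV*, `(2,4,5)` II*), two roots of `Ψ₃ = 3x⁴ + b₂x³ + 3b₄x² + 3b₆x + b₈` coincide, for
`(type, n) ∈ {(II,5), (IV,5), (IV,7), (IV*,11), (II*,11), (II*,13)}`: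
* `(II, 5)`, `(IV, 7)`: gen 3's valued cores `shapeII_five_bounds` / `shapeIV_seven_bounds` put the model on
  the "linear dominance" shape, `root_unique_of_linear_dominance`;
* `(IV, 5)`: `shapeIV_five_bounds` + `root_unique_of_shapeIV_five` (every root a unit);
* `(IV*, 11)`, `(II*, 13)`, `(II*, 11)`: the weight rescaling `cᵢ = bᵢ/π^{i/2}`, `r = x/π` (`rescale_Ψ₃_identities`:
  `4c₈ = c₂c₆ − c₄²`, `Δ(c) = Δ/π⁶`, `Ψ₃(c)(x/π) = Ψ₃(x)/π⁴`) lands on the shapes `(II,5)`, `(IV,7)`, `(IV,5)`.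
`normalForm_valuations` reads the valuations off the normal form once for all six.
References: J. H. Silverman, *Advanced Topics* (1994), IV.9.4 Steps 3, 5, 8, 10 [SilvermanATAEC1994];
I. Papadopoulos, J. Number Theory 44 (1993), Table (p = 3) [Papadopoulos1993]; J.-P. Serre, Invent. Math.
15 (1972), §1.11 [Serre1972].
-/

set_option autoImplicit false
-- single-conjunct summit: `Summit.BirchSwinnertonDyer.BirchSwinnertonDyer.…` repeats the name by design
set_option linter.dupNamespace false

noncomputable section

open scoped Classical

open Polynomial WeierstrassCurve IsDedekindDomain IsDedekindDomain.HeightOneSpectrum WithZero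
  Summit.BirchSwinnertonDyer.Rank1Residual.O5
  Summit.BirchSwinnertonDyer.Rank1Residual.O5.NonSplitAtThree

namespace Summit.BirchSwinnertonDyer.BirchSwinnertonDyer.Theorems.PSLocalThreeTorsion

/-! ## §1 The weight rescaling `cᵢ = bᵢ/ϖ^{i/2}`, `r = x/ϖ` (pure field identities) -/

section Field

variable {F : Type*} [Field F]

/-- **Rescaling identities.** For `ϖ ≠ 0` and `cᵢ := bᵢ/ϖ^{i/2}`: `4c₈ = c₂c₆ − c₄²`,
`−c₂²c₈ − 8c₄³ − 27c₆² + 9c₂c₄c₆ = Δ/ϖ⁶`, and every root `y` of `Ψ₃` gives the root `y/ϖ` of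
`3r⁴ + c₂r³ + 3c₄r² + 3c₆r + c₈` (`= Ψ₃(y)/ϖ⁴`) — the variable change `u² = ϖ` read on invariants, which
needs no square root of `ϖ`. [folklore] -/
theorem rescale_Ψ₃_identities (N : WeierstrassCurve F) {ϖ : F} (hϖ0 : ϖ ≠ 0) :
    4 * (N.b₈ / ϖ ^ 4) = N.b₂ / ϖ * (N.b₆ / ϖ ^ 3) - (N.b₄ / ϖ ^ 2) ^ 2 ∧
    -(N.b₂ / ϖ) ^ 2 * (N.b₈ / ϖ ^ 4) - 8 * (N.b₄ / ϖ ^ 2) ^ 3 - 27 * (N.b₆ / ϖ ^ 3) ^ 2 +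
        9 * (N.b₂ / ϖ) * (N.b₄ / ϖ ^ 2) * (N.b₆ / ϖ ^ 3) = N.Δ / ϖ ^ 6 ∧
    ∀ y : F, N.Ψ₃.eval y = 0 →
      3 * (y / ϖ) ^ 4 + N.b₂ / ϖ * (y / ϖ) ^ 3 + 3 * (N.b₄ / ϖ ^ 2) * (y / ϖ) ^ 2 +
        3 * (N.b₆ / ϖ ^ 3) * (y / ϖ) + N.b₈ / ϖ ^ 4 = 0 := by
  refine ⟨?_, ?_, ?_⟩
  · calc 4 * (N.b₈ / ϖ ^ 4) = (4 * N.b₈) / ϖ ^ 4 := by ring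
      _ = (N.b₂ * N.b₆ - N.b₄ ^ 2) / ϖ ^ 4 := by rw [N.b_relation]
      _ = N.b₂ / ϖ * (N.b₆ / ϖ ^ 3) - (N.b₄ / ϖ ^ 2) ^ 2 := by ring
  · rw [show N.Δ = -N.b₂ ^ 2 * N.b₈ - 8 * N.b₄ ^ 3 - 27 * N.b₆ ^ 2 + 9 * N.b₂ * N.b₄ * N.b₆ from rfl]
    ring
  · intro y hy
    rw [WeierstrassCurve.eval_Ψ₃_eq] at hy
    have h : 3 * (y / ϖ) ^ 4 + N.b₂ / ϖ * (y / ϖ) ^ 3 + 3 * (N.b₄ / ϖ ^ 2) * (y / ϖ) ^ 2 +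
        3 * (N.b₆ / ϖ ^ 3) * (y / ϖ) + N.b₈ / ϖ ^ 4 =
        (3 * y ^ 4 + N.b₂ * y ^ 3 + 3 * N.b₄ * y ^ 2 + 3 * N.b₆ * y + N.b₈) / ϖ ^ 4 := by
      field_simp
    rw [h, hy, zero_div]

end Field

/-! ## §2 Over the completion `K_v`: valuations of the normal form, and the six cells -/

section Completion

variable {A : Type*} [CommRing A] [IsDedekindDomain A] {K : Type*} [Field K] [Algebra A K]
  [IsFractionRing A K] (v : HeightOneSpectrum A)

/-- **Valuations of Tate's normal-form data.** With `ord_v π = 1`, `b₂ = π^{k₂}β₂`, `b₄ = π^{k₄}β₄`,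
`b₆ = π^{k₆}β₆` (`β₆ ∈ 𝒪_v^×`), `Δ = πⁿδ` (`δ ∈ 𝒪_v^×`): `w π = e⁻¹`, `w b₂ ≤ e^{−k₂}`, `w b₄ ≤ e^{−k₄}`,
`w b₆ = e^{−k₆}`, `w Δ = e^{−n}` (`w` the valuation of `K_v`). [folklore] -/
theorem normalForm_valuations {π : K} (hπ : v.valuation K π = exp (-1 : ℤ))
    (N : WeierstrassCurve (v.adicCompletion K)) (β₂ β₄ β₆ δ : v.adicCompletionIntegers K)
    (hβ₆ : IsUnit β₆) (hδ : IsUnit δ) {k₂ k₄ k₆ n : ℕ}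
    (hb₂ : N.b₂ = (π : v.adicCompletion K) ^ k₂ * β₂)
    (hb₄ : N.b₄ = (π : v.adicCompletion K) ^ k₄ * β₄)
    (hb₆ : N.b₆ = (π : v.adicCompletion K) ^ k₆ * β₆)
    (hΔ : N.Δ = (π : v.adicCompletion K) ^ n * δ) :
    Valued.v (π : v.adicCompletion K) = exp (-1 : ℤ) ∧
      Valued.v N.b₂ ≤ exp (-(k₂ : ℤ)) ∧ Valued.v N.b₄ ≤ exp (-(k₄ : ℤ)) ∧
      Valued.v N.b₆ = exp (-(k₆ : ℤ)) ∧
      Valued.v (-N.b₂ ^ 2 * N.b₈ - 8 * N.b₄ ^ 3 - 27 * N.b₆ ^ 2 + 9 * N.b₂ * N.b₄ * N.b₆) =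
        exp (-(n : ℤ)) := by
  set w : Valuation (v.adicCompletion K) ℤᵐ⁰ := Valued.v with hw
  set ϖ : v.adicCompletion K := (π : v.adicCompletion K) with hϖ
  have hπv : w ϖ = exp (-1 : ℤ) := by rw [hw, hϖ, valuedAdicCompletion_eq_valuation', hπ]
  have hint : ∀ β : v.adicCompletionIntegers K, w (β : v.adicCompletion K) ≤ 1 := fun β ↦ β.2
  have hunit : ∀ {β : v.adicCompletionIntegers K}, IsUnit β → w (β : v.adicCompletion K) = 1 :=
    fun hβ ↦ valued_coe_eq_one_of_isUnit v hβ
  have hpowle : ∀ (m : ℕ) (β : v.adicCompletionIntegers K),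
      w (ϖ ^ m * (β : v.adicCompletion K)) ≤ exp (-(m : ℤ)) := by
    intro m β
    rw [map_mul, map_pow, hπv, ← exp_nsmul]
    calc exp (m • (-1 : ℤ)) * w (β : v.adicCompletion K) ≤ exp (m • (-1 : ℤ)) * 1 :=
        mul_le_mul' le_rfl (hint β)
      _ = exp (-(m : ℤ)) := by simp
  have hpoweq : ∀ (m : ℕ) {β : v.adicCompletionIntegers K}, IsUnit β →
      w (ϖ ^ m * (β : v.adicCompletion K)) = exp (-(m : ℤ)) := by
    intro m β hβ
    rw [map_mul, map_pow, hπv, ← exp_nsmul, hunit hβ, mul_one]; simp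
  refine ⟨hπv, ?_, ?_, ?_, ?_⟩
  · rw [hb₂]; exact hpowle k₂ β₂
  · rw [hb₄]; exact hpowle k₄ β₄
  · rw [hb₆]; exact hpoweq k₆ hβ₆
  · rw [show -N.b₂ ^ 2 * N.b₈ - 8 * N.b₄ ^ 3 - 27 * N.b₆ ^ 2 + 9 * N.b₂ * N.b₄ * N.b₆ = N.Δ from rfl,
      hΔ]
    exact hpoweq n hδ

/-- `w (x / ϖ^m) = w x · e^{m}` for `w ϖ = e⁻¹`. [folklore] -/
theorem valued_div_pow {ϖ : v.adicCompletion K} (hπv : Valued.v ϖ = exp (-1 : ℤ))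
    (x : v.adicCompletion K) (m : ℕ) : Valued.v (x / ϖ ^ m) = Valued.v x * exp (m : ℤ) := by
  rw [map_div₀, map_pow, hπv, ← exp_nsmul, div_eq_mul_inv, ← exp_neg]
  congr 2
  simp

/-- **Cell `(5, II)`: type `II` with `v(Δ) = 5` — `Ψ₃` has at most one root in `K_v`** (normal form
`b₂ = πβ₂`, `b₄ = πβ₄`, `b₆ = πβ₆`, `Δ = π⁵δ`; linear dominance after `shapeII_five_bounds`).
[cite: SilvermanATAEC1994, IV.9.4 Step 3 (normal form of type II)] -/
theorem Ψ₃_root_unique_of_shapeII_five {π : K} (hπ : v.valuation K π = exp (-1 : ℤ))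
    (h3 : (π : v.adicCompletion K) = 3) (N : WeierstrassCurve (v.adicCompletion K))
    (β₂ β₄ β₆ δ : v.adicCompletionIntegers K) (hβ₆ : IsUnit β₆) (hδ : IsUnit δ)
    (hb₂ : N.b₂ = (π : v.adicCompletion K) ^ 1 * β₂)
    (hb₄ : N.b₄ = (π : v.adicCompletion K) ^ 1 * β₄)
    (hb₆ : N.b₆ = (π : v.adicCompletion K) ^ 1 * β₆)
    (hΔ : N.Δ = (π : v.adicCompletion K) ^ 5 * δ) (z z' : v.adicCompletion K)
    (hz : N.Ψ₃.eval z = 0) (hz' : N.Ψ₃.eval z' = 0) : z = z' := by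
  set w : Valuation (v.adicCompletion K) ℤᵐ⁰ := Valued.v with hw
  obtain ⟨hπv, wb₂, wb₄, wb₆, wΔ⟩ := normalForm_valuations v hπ N β₂ β₄ β₆ δ hβ₆ hδ hb₂ hb₄ hb₆ hΔ
  have h3' : (3 : v.adicCompletion K) = (π : v.adicCompletion K) := h3.symm
  have wb₆' : w N.b₆ = exp (-1 : ℤ) := wb₆
  obtain ⟨wb₂', wb₄', wb₈'⟩ := shapeII_five_bounds w h3' hπv wb₂ wb₄ wb₆' N.b_relation wΔ
  rw [WeierstrassCurve.eval_Ψ₃_eq] at hz hz'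
  exact root_unique_of_linear_dominance w h3' hπv wb₂' wb₄' (by rw [wb₆', exp_lt_exp]; norm_num)
    (by rw [wb₆', ← exp_zero, exp_lt_exp]; norm_num) wb₈' hz hz'

/-- **Cell `(5, IV)`: type `IV` with `v(Δ) = 7` — `Ψ₃` has at most one root in `K_v`** (normal form
`b₂ = πβ₂`, `b₄ = π²β₄`, `b₆ = π²β₆`, `Δ = π⁷δ`; linear dominance after `shapeIV_seven_bounds`).
[cite: SilvermanATAEC1994, IV.9.4 Step 5 (normal form of type IV)] -/
theorem Ψ₃_root_unique_of_shapeIV_seven {π : K} (hπ : v.valuation K π = exp (-1 : ℤ))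
    (h3 : (π : v.adicCompletion K) = 3) (N : WeierstrassCurve (v.adicCompletion K))
    (β₂ β₄ β₆ δ : v.adicCompletionIntegers K) (hβ₆ : IsUnit β₆) (hδ : IsUnit δ)
    (hb₂ : N.b₂ = (π : v.adicCompletion K) ^ 1 * β₂)
    (hb₄ : N.b₄ = (π : v.adicCompletion K) ^ 2 * β₄)
    (hb₆ : N.b₆ = (π : v.adicCompletion K) ^ 2 * β₆)
    (hΔ : N.Δ = (π : v.adicCompletion K) ^ 7 * δ) (z z' : v.adicCompletion K)
    (hz : N.Ψ₃.eval z = 0) (hz' : N.Ψ₃.eval z' = 0) : z = z' := by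
  set w : Valuation (v.adicCompletion K) ℤᵐ⁰ := Valued.v with hw
  obtain ⟨hπv, wb₂, wb₄, wb₆, wΔ⟩ := normalForm_valuations v hπ N β₂ β₄ β₆ δ hβ₆ hδ hb₂ hb₄ hb₆ hΔ
  have h3' : (3 : v.adicCompletion K) = (π : v.adicCompletion K) := h3.symm
  have wb₆' : w N.b₆ = exp (-2 : ℤ) := wb₆
  obtain ⟨wb₂', wb₄', wb₈'⟩ := shapeIV_seven_bounds w h3' hπv wb₂ wb₄ wb₆' N.b_relation wΔ
  rw [WeierstrassCurve.eval_Ψ₃_eq] at hz hz'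
  exact root_unique_of_linear_dominance w h3' hπv wb₂'
    (wb₄'.trans (by rw [exp_le_exp]; norm_num)) (by rw [wb₆', exp_lt_exp]; norm_num)
    (by rw [wb₆', ← exp_zero, exp_lt_exp]; norm_num) (wb₈'.trans (by rw [exp_le_exp]; norm_num)) hz hz'

/-- **Cell `(3, IV)`: type `IV` with `v(Δ) = 5` — `Ψ₃` has at most one root in `K_v`** (normal form
`b₂ = πβ₂`, `b₄ = π²β₄`, `b₆ = π²β₆`, `Δ = π⁵δ`; `shapeIV_five_bounds` + `root_unique_of_shapeIV_five`: every
root is a unit and `12r³` dominates the difference quotient). [cite: SilvermanATAEC1994, IV.9.4 Step 5 (normal form of type IV)] -/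
theorem Ψ₃_root_unique_of_shapeIV_five {π : K} (hπ : v.valuation K π = exp (-1 : ℤ))
    (h3 : (π : v.adicCompletion K) = 3) (N : WeierstrassCurve (v.adicCompletion K))
    (β₂ β₄ β₆ δ : v.adicCompletionIntegers K) (hβ₆ : IsUnit β₆) (hδ : IsUnit δ)
    (hb₂ : N.b₂ = (π : v.adicCompletion K) ^ 1 * β₂)
    (hb₄ : N.b₄ = (π : v.adicCompletion K) ^ 2 * β₄)
    (hb₆ : N.b₆ = (π : v.adicCompletion K) ^ 2 * β₆)
    (hΔ : N.Δ = (π : v.adicCompletion K) ^ 5 * δ) (z z' : v.adicCompletion K)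
    (hz : N.Ψ₃.eval z = 0) (hz' : N.Ψ₃.eval z' = 0) : z = z' := by
  set w : Valuation (v.adicCompletion K) ℤᵐ⁰ := Valued.v with hw
  obtain ⟨hπv, wb₂, wb₄, wb₆, wΔ⟩ := normalForm_valuations v hπ N β₂ β₄ β₆ δ hβ₆ hδ hb₂ hb₄ hb₆ hΔ
  have h3' : (3 : v.adicCompletion K) = (π : v.adicCompletion K) := h3.symm
  have wb₆' : w N.b₆ = exp (-2 : ℤ) := wb₆
  obtain ⟨wb₂', wb₈'⟩ := shapeIV_five_bounds w h3' hπv wb₂ wb₄ wb₆' N.b_relation wΔ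
  rw [WeierstrassCurve.eval_Ψ₃_eq] at hz hz'
  exact root_unique_of_shapeIV_five w h3' hπv wb₂' wb₄ wb₆' wb₈' hz hz'

/-- **Cell `(5, IV*)`: type `IV*` with `v(Δ) = 11` — `Ψ₃` has at most one root in `K_v`** (normal form
`b₂ = π²β₂`, `b₄ = π³β₄`, `b₆ = π⁴β₆`, `Δ = π¹¹δ`; the rescaling `cᵢ = bᵢ/π^{i/2}` is on the type-`II` shape with
`w Δ(c) = e⁻⁵`, and `r = x/π` solves the rescaled `Ψ₃`). [cite: SilvermanATAEC1994, IV.9.4 Step 8 (normal form of type IV*)] -/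
theorem Ψ₃_root_unique_of_shapeIVstar_eleven {π : K} (hπ : v.valuation K π = exp (-1 : ℤ))
    (h3 : (π : v.adicCompletion K) = 3) (N : WeierstrassCurve (v.adicCompletion K))
    (β₂ β₄ β₆ δ : v.adicCompletionIntegers K) (hβ₆ : IsUnit β₆) (hδ : IsUnit δ)
    (hb₂ : N.b₂ = (π : v.adicCompletion K) ^ 2 * β₂)
    (hb₄ : N.b₄ = (π : v.adicCompletion K) ^ 3 * β₄)
    (hb₆ : N.b₆ = (π : v.adicCompletion K) ^ 4 * β₆)
    (hΔ : N.Δ = (π : v.adicCompletion K) ^ 11 * δ) (z z' : v.adicCompletion K)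
    (hz : N.Ψ₃.eval z = 0) (hz' : N.Ψ₃.eval z' = 0) : z = z' := by
  obtain ⟨hπv, wb₂, wb₄, wb₆, wΔ⟩ := normalForm_valuations v hπ N β₂ β₄ β₆ δ hβ₆ hδ hb₂ hb₄ hb₆ hΔ
  set w : Valuation (v.adicCompletion K) ℤᵐ⁰ := Valued.v with hw
  set ϖ : v.adicCompletion K := (π : v.adicCompletion K) with hϖ
  have hϖ0 : ϖ ≠ 0 := by
    intro h0; rw [h0, map_zero] at hπv; exact exp_ne_zero hπv.symm
  have h3' : (3 : v.adicCompletion K) = ϖ := h3.symm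
  obtain ⟨hrel, hΔc, hresc⟩ := rescale_Ψ₃_identities N hϖ0
  have wΔ' : w N.Δ = exp (-11 : ℤ) := wΔ
  have wc₂ : w (N.b₂ / ϖ) ≤ exp (-1 : ℤ) := by
    have h := valued_div_pow v hπv N.b₂ 1
    rw [pow_one] at h
    rw [h]
    calc w N.b₂ * exp ((1 : ℕ) : ℤ) ≤ exp (-2 : ℤ) * exp ((1 : ℕ) : ℤ) := mul_le_mul' wb₂ le_rfl
      _ = exp (-1 : ℤ) := by rw [← exp_add]; norm_num
  have wc₄ : w (N.b₄ / ϖ ^ 2) ≤ exp (-1 : ℤ) := by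
    rw [valued_div_pow v hπv]
    calc w N.b₄ * exp ((2 : ℕ) : ℤ) ≤ exp (-3 : ℤ) * exp ((2 : ℕ) : ℤ) := mul_le_mul' wb₄ le_rfl
      _ = exp (-1 : ℤ) := by rw [← exp_add]; norm_num
  have wc₆ : w (N.b₆ / ϖ ^ 3) = exp (-1 : ℤ) := by
    rw [valued_div_pow v hπv, show w N.b₆ = exp (-4 : ℤ) from wb₆, ← exp_add]; norm_num
  have wΔc : w (-(N.b₂ / ϖ) ^ 2 * (N.b₈ / ϖ ^ 4) - 8 * (N.b₄ / ϖ ^ 2) ^ 3 - 27 * (N.b₆ / ϖ ^ 3) ^ 2 +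
      9 * (N.b₂ / ϖ) * (N.b₄ / ϖ ^ 2) * (N.b₆ / ϖ ^ 3)) = exp (-5 : ℤ) := by
    rw [hΔc, valued_div_pow v hπv, wΔ', ← exp_add]; norm_num
  obtain ⟨wc₂', wc₄', wc₈'⟩ := shapeII_five_bounds w h3' hπv wc₂ wc₄ wc₆ hrel wΔc
  have heq : z / ϖ = z' / ϖ :=
    root_unique_of_linear_dominance w h3' hπv wc₂' wc₄' (by rw [wc₆, exp_lt_exp]; norm_num)
      (by rw [wc₆, ← exp_zero, exp_lt_exp]; norm_num) wc₈' (hresc z hz) (hresc z' hz')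
  have := congrArg (· * ϖ) heq
  simpa [div_mul_cancel₀ _ hϖ0] using this

/-- **Cell `(5, II*)`: type `II*` with `v(Δ) = 13` — `Ψ₃` has at most one root in `K_v`** (normal form
`b₂ = π²β₂`, `b₄ = π⁴β₄`, `b₆ = π⁵β₆`, `Δ = π¹³δ`; the rescaling `cᵢ = bᵢ/π^{i/2}` is on the type-`IV` shape with
`w Δ(c) = e⁻⁷`). [cite: SilvermanATAEC1994, IV.9.4 Step 10 (normal form of type II*)] -/
theorem Ψ₃_root_unique_of_shapeIIstar_thirteen {π : K} (hπ : v.valuation K π = exp (-1 : ℤ))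
    (h3 : (π : v.adicCompletion K) = 3) (N : WeierstrassCurve (v.adicCompletion K))
    (β₂ β₄ β₆ δ : v.adicCompletionIntegers K) (hβ₆ : IsUnit β₆) (hδ : IsUnit δ)
    (hb₂ : N.b₂ = (π : v.adicCompletion K) ^ 2 * β₂)
    (hb₄ : N.b₄ = (π : v.adicCompletion K) ^ 4 * β₄)
    (hb₆ : N.b₆ = (π : v.adicCompletion K) ^ 5 * β₆)
    (hΔ : N.Δ = (π : v.adicCompletion K) ^ 13 * δ) (z z' : v.adicCompletion K)
    (hz : N.Ψ₃.eval z = 0) (hz' : N.Ψ₃.eval z' = 0) : z = z' := by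
  obtain ⟨hπv, wb₂, wb₄, wb₆, wΔ⟩ := normalForm_valuations v hπ N β₂ β₄ β₆ δ hβ₆ hδ hb₂ hb₄ hb₆ hΔ
  set w : Valuation (v.adicCompletion K) ℤᵐ⁰ := Valued.v with hw
  set ϖ : v.adicCompletion K := (π : v.adicCompletion K) with hϖ
  have hϖ0 : ϖ ≠ 0 := by
    intro h0; rw [h0, map_zero] at hπv; exact exp_ne_zero hπv.symm
  have h3' : (3 : v.adicCompletion K) = ϖ := h3.symm
  obtain ⟨hrel, hΔc, hresc⟩ := rescale_Ψ₃_identities N hϖ0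
  have wΔ' : w N.Δ = exp (-13 : ℤ) := wΔ
  have wc₂ : w (N.b₂ / ϖ) ≤ exp (-1 : ℤ) := by
    have h := valued_div_pow v hπv N.b₂ 1
    rw [pow_one] at h
    rw [h]
    calc w N.b₂ * exp ((1 : ℕ) : ℤ) ≤ exp (-2 : ℤ) * exp ((1 : ℕ) : ℤ) := mul_le_mul' wb₂ le_rfl
      _ = exp (-1 : ℤ) := by rw [← exp_add]; norm_num
  have wc₄ : w (N.b₄ / ϖ ^ 2) ≤ exp (-2 : ℤ) := by
    rw [valued_div_pow v hπv]
    calc w N.b₄ * exp ((2 : ℕ) : ℤ) ≤ exp (-4 : ℤ) * exp ((2 : ℕ) : ℤ) := mul_le_mul' wb₄ le_rfl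
      _ = exp (-2 : ℤ) := by rw [← exp_add]; norm_num
  have wc₆ : w (N.b₆ / ϖ ^ 3) = exp (-2 : ℤ) := by
    rw [valued_div_pow v hπv, show w N.b₆ = exp (-5 : ℤ) from wb₆, ← exp_add]; norm_num
  have wΔc : w (-(N.b₂ / ϖ) ^ 2 * (N.b₈ / ϖ ^ 4) - 8 * (N.b₄ / ϖ ^ 2) ^ 3 - 27 * (N.b₆ / ϖ ^ 3) ^ 2 +
      9 * (N.b₂ / ϖ) * (N.b₄ / ϖ ^ 2) * (N.b₆ / ϖ ^ 3)) = exp (-7 : ℤ) := by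
    rw [hΔc, valued_div_pow v hπv, wΔ', ← exp_add]; norm_num
  obtain ⟨wc₂', wc₄', wc₈'⟩ := shapeIV_seven_bounds w h3' hπv wc₂ wc₄ wc₆ hrel wΔc
  have heq : z / ϖ = z' / ϖ :=
    root_unique_of_linear_dominance w h3' hπv wc₂' (wc₄'.trans (by rw [exp_le_exp]; norm_num))
      (by rw [wc₆, exp_lt_exp]; norm_num) (by rw [wc₆, ← exp_zero, exp_lt_exp]; norm_num)
      (wc₈'.trans (by rw [exp_le_exp]; norm_num)) (hresc z hz) (hresc z' hz')
  have := congrArg (· * ϖ) heq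
  simpa [div_mul_cancel₀ _ hϖ0] using this

/-- **Cell `(3, II*)`: type `II*` with `v(Δ) = 11` — `Ψ₃` has at most one root in `K_v`** (normal form
`b₂ = π²β₂`, `b₄ = π⁴β₄`, `b₆ = π⁵β₆`, `Δ = π¹¹δ`; the rescaling `cᵢ = bᵢ/π^{i/2}` is on the type-`IV` shape with
`w Δ(c) = e⁻⁵`, every rescaled root is a unit). [cite: SilvermanATAEC1994, IV.9.4 Step 10 (normal form of type II*)] -/
theorem Ψ₃_root_unique_of_shapeIIstar_eleven {π : K} (hπ : v.valuation K π = exp (-1 : ℤ))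
    (h3 : (π : v.adicCompletion K) = 3) (N : WeierstrassCurve (v.adicCompletion K))
    (β₂ β₄ β₆ δ : v.adicCompletionIntegers K) (hβ₆ : IsUnit β₆) (hδ : IsUnit δ)
    (hb₂ : N.b₂ = (π : v.adicCompletion K) ^ 2 * β₂)
    (hb₄ : N.b₄ = (π : v.adicCompletion K) ^ 4 * β₄)
    (hb₆ : N.b₆ = (π : v.adicCompletion K) ^ 5 * β₆)
    (hΔ : N.Δ = (π : v.adicCompletion K) ^ 11 * δ) (z z' : v.adicCompletion K)
    (hz : N.Ψ₃.eval z = 0) (hz' : N.Ψ₃.eval z' = 0) : z = z' := by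
  obtain ⟨hπv, wb₂, wb₄, wb₆, wΔ⟩ := normalForm_valuations v hπ N β₂ β₄ β₆ δ hβ₆ hδ hb₂ hb₄ hb₆ hΔ
  set w : Valuation (v.adicCompletion K) ℤᵐ⁰ := Valued.v with hw
  set ϖ : v.adicCompletion K := (π : v.adicCompletion K) with hϖ
  have hϖ0 : ϖ ≠ 0 := by
    intro h0; rw [h0, map_zero] at hπv; exact exp_ne_zero hπv.symm
  have h3' : (3 : v.adicCompletion K) = ϖ := h3.symm
  obtain ⟨hrel, hΔc, hresc⟩ := rescale_Ψ₃_identities N hϖ0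
  have wΔ' : w N.Δ = exp (-11 : ℤ) := wΔ
  have wc₂ : w (N.b₂ / ϖ) ≤ exp (-1 : ℤ) := by
    have h := valued_div_pow v hπv N.b₂ 1
    rw [pow_one] at h
    rw [h]
    calc w N.b₂ * exp ((1 : ℕ) : ℤ) ≤ exp (-2 : ℤ) * exp ((1 : ℕ) : ℤ) := mul_le_mul' wb₂ le_rfl
      _ = exp (-1 : ℤ) := by rw [← exp_add]; norm_num
  have wc₄ : w (N.b₄ / ϖ ^ 2) ≤ exp (-2 : ℤ) := by
    rw [valued_div_pow v hπv]
    calc w N.b₄ * exp ((2 : ℕ) : ℤ) ≤ exp (-4 : ℤ) * exp ((2 : ℕ) : ℤ) := mul_le_mul' wb₄ le_rfl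
      _ = exp (-2 : ℤ) := by rw [← exp_add]; norm_num
  have wc₆ : w (N.b₆ / ϖ ^ 3) = exp (-2 : ℤ) := by
    rw [valued_div_pow v hπv, show w N.b₆ = exp (-5 : ℤ) from wb₆, ← exp_add]; norm_num
  have wΔc : w (-(N.b₂ / ϖ) ^ 2 * (N.b₈ / ϖ ^ 4) - 8 * (N.b₄ / ϖ ^ 2) ^ 3 - 27 * (N.b₆ / ϖ ^ 3) ^ 2 +
      9 * (N.b₂ / ϖ) * (N.b₄ / ϖ ^ 2) * (N.b₆ / ϖ ^ 3)) = exp (-5 : ℤ) := by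
    rw [hΔc, valued_div_pow v hπv, wΔ', ← exp_add]; norm_num
  obtain ⟨wc₂', wc₈'⟩ := shapeIV_five_bounds w h3' hπv wc₂ wc₄ wc₆ hrel wΔc
  have heq : z / ϖ = z' / ϖ :=
    root_unique_of_shapeIV_five w h3' hπv wc₂' wc₄ wc₆ wc₈' (hresc z hz) (hresc z' hz')
  have := congrArg (· * ϖ) heq
  simpa [div_mul_cancel₀ _ hϖ0] using this

end Completion

end Summit.BirchSwinnertonDyer.BirchSwinnertonDyer.Theorems.PSLocalThreeTorsion

end
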